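import Literature.GroupTheory.CombinatorialGroupTheory.FreeFactorFiniteIndex
import Literature.GroupTheory.CombinatorialGroupTheory.FreeGroupNoncommutingPair
import Mathlib.Data.ZMod.Basic
import Mathlib.Data.Fin.VecNotation
import Mathlib.Algebra.Group.TypeTags.Finite
import HarnessLib

/-!
# Two non-commuting elements of a free group have independent orders modulo a suitable finite quotient

Topic `Literature/GroupTheory/CombinatorialGroupTheory`; theorems only.  **Theorem** (the finite-quotient
form of the malnormality of cyclic subgroups used in P. F. Stebe's and J. L. Dyer's separation of
conjugacy classes in free products with cyclic amalgamation — Dyer, J. Austral. Math. Soc. (A) 29 (1980),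
proof of Thm. 7 Case 3 p.45–46 and Thm. 10 p.48, where the exponents of the sliding equations
`h_{i-1} u_i = v_i h_i` are compared in a quotient; there via torsion-free nilpotent quotients, here via
M. Hall's theorem): *let `c, d` be NON-COMMUTING elements of a free group `F` and `L ≥ 1`.  Then there is
a normal subgroup `N` of finite index in `F` such that `c^a d^b ∈ N` implies `L ∣ a` and `L ∣ b`* — in
`F ⧸ N` the cyclic subgroups `⟨c̄⟩`, `⟨d̄⟩` meet trivially "modulo `L`" and both `c̄`, `d̄` have order
divisible by `L`:

* `FreeGroup.exists_normal_finiteIndex_zpow_mul_zpow_mem` — the statement above, for `F = F(α)` with `α`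
  finite;
* `FreeGroup.exists_normal_finiteIndex_conj_zpow_mul_zpow_mem` — the form in which it is used: for `u` with
  `c · (u c u⁻¹) ≠ (u c u⁻¹) · c` (e.g. `u ∉ ⟨c⟩` with `⟨c⟩` malnormal), `u⁻¹ c^a u c^b ∈ N ⟹ L ∣ a ∧ L ∣ b`,
  i.e. the solutions `(n, n')` modulo `N` of a sliding equation `cⁿ u = v c^{n'}` are congruent modulo `L`
  to its unique solution in `F`.

Proof: `c, d` freely generate `E = ⟨c, d⟩` (two non-commuting elements of a free group form a free basis:
tree `FreeGroupNoncommutingPair.lift_injective_of_mul_ne`, Lyndon–Schupp I Prop. 2.5/2.7); by M. Hall's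
theorem in free-factor form (tree `FreeFactor.exists_finiteIndex_freeFactor`, Lyndon–Schupp I Prop. 3.10)
`E` is a free factor of a subgroup `K` of finite index, so the homomorphism `E → ℤ/L × ℤ/L`, `c ↦ (1,0)`,
`d ↦ (0,1)` extends to `K`; take `N` = the normal core of its kernel.

## References

* J. L. Dyer, *Separating conjugates in amalgamated free products and HNN extensions*, J. Austral.
  Math. Soc. Ser. A 29 (1980) 35–51, Thm. 7 Case 3, Thm. 10. [Dyer1980]
* R. C. Lyndon, P. E. Schupp, *Combinatorial Group Theory*, Springer (1977); Classics in
  Mathematics (2001), Ch. I Prop. 2.7, Prop. 3.10. [LyndonSchupp2001]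
-/

namespace Literature.GroupTheory.CombinatorialGroupTheory

namespace FreeGroupCyclicIndependence

universe u

/-- **Two non-commuting elements of `F(α)` (`α` finite) freely generate a subgroup**: an injective
homomorphism `F(Fin 2) → F(α)` with `x₀ ↦ c`, `x₁ ↦ d`. [cite: LyndonSchupp2001, Ch. I Prop. 2.7] -/
theorem exists_hom_injective_of_mul_ne {α : Type u} [Finite α] {c d : FreeGroup α}
    (hcd : c * d ≠ d * c) :
    ∃ ψ : FreeGroup (Fin 2) →* FreeGroup α, Function.Injective ψ ∧
      ψ (FreeGroup.of 0) = c ∧ ψ (FreeGroup.of 1) = d := by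
  classical
  obtain ⟨k, ⟨e⟩⟩ := Finite.exists_equiv_fin α
  let θ : FreeGroup α ≃* FreeGroup (Fin k) := FreeGroup.freeGroupCongr e
  let u : Fin 2 → FreeGroup (Fin k) := ![θ c, θ d]
  have hu : u 0 * u 1 ≠ u 1 * u 0 := by
    intro h
    apply hcd
    apply θ.injective
    rw [map_mul, map_mul]
    simpa [u] using h
  have hinj := lift_injective_of_mul_ne u hu
  refine ⟨θ.symm.toMonoidHom.comp (FreeGroup.lift u), θ.symm.injective.comp hinj, ?_, ?_⟩
  · simp [u]
  · simp [u]

/-- Evaluating the homomorphism defined on a free basis at a basis element. [folklore] -/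
private theorem basis_lift_apply {ι G H : Type*} [Group G] [Group H] (b : FreeGroupBasis ι G)
    (f : ι → H) (i : ι) : b.lift f (b i) = f i := by
  change FreeGroup.lift f (b.repr (b i)) = f i
  rw [FreeGroupBasis.repr_apply_coe, FreeGroup.lift_apply_of]

/-- **M. Hall's theorem as a virtual retraction, for homomorphisms**: a homomorphism from a finitely
generated subgroup `H` of a free group to any group `M` extends to some subgroup `K ≥ H` of finite index
(`H` is a free factor of such a `K`). [cite: LyndonSchupp2001, Ch. I Prop. 3.10] -/
theorem exists_finiteIndex_hom_extends {G : Type u} [Group G] [IsFreeGroup G] (H : Subgroup G)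
    (hH : H.FG) {M : Type*} [Group M] (χ : H →* M) :
    ∃ (K : Subgroup G) (hHK : H ≤ K) (χK : K →* M), K.FiniteIndex ∧
      ∀ h : H, χK (Subgroup.inclusion hHK h) = χ h := by
  obtain ⟨K, hKf, hHK, κ, s, bK, bH, -, hcoe⟩ := FreeFactor.exists_finiteIndex_freeFactor H hH
  -- extend by `χ` on the `s`-part of the basis and trivially on the complement
  let f : ↥s ⊕ ↥sᶜ → M := fun x => Sum.elim (fun i => χ (bH i)) (fun _ => 1) x
  refine ⟨K, hHK, bK.lift f, hKf, ?_⟩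
  -- the two homomorphisms `H → M` agree on the basis `bH`
  have key : (bK.lift f).comp (Subgroup.inclusion hHK) = χ := by
    refine bH.ext_hom _ _ (fun i => ?_)
    have hi : Subgroup.inclusion hHK (bH i) = bK (Sum.inl i) := Subtype.ext (hcoe i)
    rw [MonoidHom.comp_apply, hi, basis_lift_apply]
    rfl
  intro h
  rw [← MonoidHom.comp_apply, key]

/-- From an extension to a finite-index subgroup to a normal subgroup of finite index: if `χK : K → M`
extends `χ : H → M` (`K` of finite index), the normal core `N` of `ker χK` is a normal subgroup of finite
index of `G` with `N ∩ H ≤ ker χ` (when `M` is finite). [cite: LyndonSchupp2001, Ch. I Prop. 3.10] -/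
theorem exists_normal_finiteIndex_inf_le_ker {G : Type u} [Group G] [IsFreeGroup G] (H : Subgroup G)
    (hH : H.FG) {M : Type*} [Group M] [Finite M] (χ : H →* M) :
    ∃ N : Subgroup G, N.Normal ∧ N.FiniteIndex ∧ ∀ h : H, (h : G) ∈ N → χ h = 1 := by
  obtain ⟨K, hHK, χK, hKf, hext⟩ := exists_finiteIndex_hom_extends H hH χ
  haveI := hKf
  -- the kernel of `χK`, pushed into `G`, has finite index
  let L : Subgroup G := χK.ker.map K.subtype
  haveI : χK.ker.FiniteIndex := by
    haveI : Finite χK.range := inferInstance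
    exact Subgroup.finiteIndex_ker _
  haveI hLf : L.FiniteIndex := by
    constructor
    rw [Subgroup.index_map_subtype]
    exact mul_ne_zero Subgroup.FiniteIndex.index_ne_zero hKf.index_ne_zero
  refine ⟨L.normalCore, inferInstance, inferInstance, fun h hh => ?_⟩
  have hL : (h : G) ∈ L := Subgroup.normalCore_le L hh
  obtain ⟨k, hk, hkh⟩ := Subgroup.mem_map.mp hL
  have hk' : k = Subgroup.inclusion hHK h := Subtype.ext (by simpa using hkh)
  rw [← hext h, ← hk']
  exact hk

/-- **Independence of two non-commuting elements modulo a finite quotient.**  Let `c, d ∈ F(α)`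
(`α` finite) with `c d ≠ d c` and `L ≥ 1`.  Then there is a normal subgroup `N` of finite index in `F(α)`
such that `c^a · d^b ∈ N` implies `L ∣ a` and `L ∣ b` (Dyer's comparison of exponents, done in a finite
quotient instead of a torsion-free nilpotent one). [cite: Dyer1980, Thm. 7 Case 3 p.45] -/
theorem _root_.FreeGroup.exists_normal_finiteIndex_zpow_mul_zpow_mem {α : Type u} [Finite α]
    {c d : FreeGroup α} (hcd : c * d ≠ d * c) (L : ℕ) (hL : 0 < L) :
    ∃ N : Subgroup (FreeGroup α), N.Normal ∧ N.FiniteIndex ∧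
      ∀ a b : ℤ, c ^ a * d ^ b ∈ N → (L : ℤ) ∣ a ∧ (L : ℤ) ∣ b := by
  classical
  haveI : NeZero L := ⟨hL.ne'⟩
  obtain ⟨ψ, hψ, hψ0, hψ1⟩ := exists_hom_injective_of_mul_ne hcd
  -- `H = ⟨c, d⟩ = range ψ`, free on `c, d`
  let H : Subgroup (FreeGroup α) := ψ.range
  have hH : H.FG := by
    refine ⟨{c, d}, ?_⟩
    change Subgroup.closure (({c, d} : Finset (FreeGroup α)) : Set (FreeGroup α)) = ψ.range
    rw [Finset.coe_insert, Finset.coe_singleton, MonoidHom.range_eq_map, ← FreeGroup.closure_range_of,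
      MonoidHom.map_closure]
    congr 1
    ext x
    simp only [Set.mem_insert_iff, Set.mem_singleton_iff, Set.mem_image, Set.mem_range]
    constructor
    · rintro (rfl | rfl)
      · exact ⟨FreeGroup.of 0, ⟨0, rfl⟩, hψ0⟩
      · exact ⟨FreeGroup.of 1, ⟨1, rfl⟩, hψ1⟩
    · rintro ⟨_, ⟨i, rfl⟩, rfl⟩
      fin_cases i
      · exact Or.inl hψ0
      · exact Or.inr hψ1
  let eH : FreeGroup (Fin 2) ≃* H := MonoidHom.ofInjective hψ
  -- the homomorphism `H → ℤ/L × ℤ/L`, `c ↦ (1, 0)`, `d ↦ (0, 1)`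
  let g : Fin 2 → Multiplicative (ZMod L) × Multiplicative (ZMod L) :=
    ![(Multiplicative.ofAdd 1, 1), (1, Multiplicative.ofAdd 1)]
  let χ : H →* Multiplicative (ZMod L) × Multiplicative (ZMod L) :=
    (FreeGroup.lift g).comp eH.symm.toMonoidHom
  have hχ : ∀ w : FreeGroup (Fin 2), χ (eH w) = FreeGroup.lift g w := fun w => by
    simp only [χ, MonoidHom.comp_apply, MulEquiv.coe_toMonoidHom, MulEquiv.symm_apply_apply]
  obtain ⟨N, hNn, hNf, hN⟩ := exists_normal_finiteIndex_inf_le_ker H hH χ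
  refine ⟨N, hNn, hNf, fun a b hab => ?_⟩
  -- `c^a d^b = ψ (x₀^a x₁^b)` lies in `H`; evaluate `χ` there
  set w : FreeGroup (Fin 2) := FreeGroup.of 0 ^ a * FreeGroup.of 1 ^ b with hw
  have hψw : ψ w = c ^ a * d ^ b := by rw [hw, map_mul, map_zpow, map_zpow, hψ0, hψ1]
  have hmem : ((eH w : H) : FreeGroup α) ∈ N := by
    rw [MonoidHom.ofInjective_apply, hψw]; exact hab
  have h1 := hN (eH w) hmem
  rw [hχ, hw, map_mul, map_zpow, map_zpow, FreeGroup.lift_apply_of, FreeGroup.lift_apply_of] at h1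
  have h1' : ((Multiplicative.ofAdd (1 : ZMod L), (1 : Multiplicative (ZMod L))) ^ a *
      ((1 : Multiplicative (ZMod L)), Multiplicative.ofAdd (1 : ZMod L)) ^ b) = 1 := h1
  rw [Prod.pow_mk, Prod.pow_mk, Prod.mk_mul_mk, one_zpow, one_zpow, mul_one, one_mul,
    Prod.mk_eq_one] at h1'
  have key : ∀ z : ℤ, Multiplicative.ofAdd (1 : ZMod L) ^ z = 1 → (L : ℤ) ∣ z := by
    intro z hz
    rw [← ofAdd_zsmul, Int.smul_one_eq_cast, ofAdd_eq_one] at hz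
    exact (ZMod.intCast_zmod_eq_zero_iff_dvd z L).mp hz
  exact ⟨key a h1'.1, key b h1'.2⟩

/-- **The form used for sliding equations.**  If `c` and `u c u⁻¹` do not commute (e.g. `⟨c⟩` malnormal
and `u ∉ ⟨c⟩`) and `L ≥ 1`, some normal subgroup `N` of finite index satisfies: `u⁻¹ c^a u c^b ∈ N`
implies `L ∣ a` and `L ∣ b` — so two solutions `(n, n')`, `(m, m')` modulo `N` of the equation
`cⁿ u ≡ v c^{n'}` are congruent modulo `L` (apply to `a = n − m`, `b = m' − n'`).
[cite: Dyer1980, Thm. 7 Case 3 p.45] -/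
theorem _root_.FreeGroup.exists_normal_finiteIndex_conj_zpow_mul_zpow_mem {α : Type u} [Finite α]
    {c u : FreeGroup α} (hcu : c * (u * c * u⁻¹) ≠ (u * c * u⁻¹) * c) (L : ℕ) (hL : 0 < L) :
    ∃ N : Subgroup (FreeGroup α), N.Normal ∧ N.FiniteIndex ∧
      ∀ a b : ℤ, u⁻¹ * c ^ a * u * c ^ b ∈ N → (L : ℤ) ∣ a ∧ (L : ℤ) ∣ b := by
  obtain ⟨N, hNn, hNf, hN⟩ :=
    FreeGroup.exists_normal_finiteIndex_zpow_mul_zpow_mem hcu L hL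
  haveI := hNn
  refine ⟨N, hNn, hNf, fun a b hab => ?_⟩
  -- `u⁻¹ c^a u c^b ∈ N` iff its `u`-conjugate `c^a (u c u⁻¹)^b` is
  have h1 : c ^ a * (u * c * u⁻¹) ^ b = u * (u⁻¹ * c ^ a * u * c ^ b) * u⁻¹ := by
    rw [conj_zpow]; group
  have h2 : c ^ a * (u * c * u⁻¹) ^ b ∈ N := by
    rw [h1]; exact hNn.conj_mem _ hab u
  exact hN a b h2

end FreeGroupCyclicIndependence

end Literature.GroupTheory.CombinatorialGroupTheory
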